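/-
Copyright (c) 2026 the pub-hodgecm-mathlib formalisation cell (harness21).  Prover seat hodgecm-mathlib-K2E3-p32 (g0), HCML Track B «K2-LIT» (close-out strike line L4
`stub_StCharTS`), h413 = `stmt-HodgeConjecture-24833`, line `K2_E3_EllipticInputs`, unit U4 «Keys», PART «U4Keys» socket :155 (U4f-χ₁-ram-one-d0B)
`sig_K2E3KeysThmTwoContractingRamifiedCharOneDepthZeroNormTrivial` (LINE-LEAD K2E3-plan (g4) EMIT #5, deal D162, cell «U4-RAM»; plan of record K2E3-p06 (g4) DESIGN-M2-v2 (O2),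
step Z2-B «the type plane in Branch B»), GENERIC part: «REDUCIBLE ⟹ det M = 0» — a `(B, θ)`-type vector killed by two functionals makes the `2 × 2` CASSELMAN-PAIR MATRIX of the
functionals on the type basis `(f₁, f_w)` SINGULAR.  2026-09-04.
-/
import Summits.HodgeConjecture.HodgeConjecture.Theorems.K2E3IwahoriPlaneTwoCells       -- ★ Z2 (K2E3-p06 (g4)) p859358: `eq_of_eigen_of_apply_eq` (the `(B, θ)`-plane embeds in `ℂ²` by `f ↦ (f 1, f g₀)`); brings ★ `Representation.SmoothInd`, ★ Z2-gen
import Summits.HodgeConjecture.HodgeConjecture.Theorems.K2E3BranchAContradiction       -- ★ Z2A-4 (K2E3-p06 (g4)) p858377: the Branch-A twin (one functional, one type vector); brings the Bochner integral on `↥N`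
import HarnessLib

/-!
# K2 ∕ E3 «EllipticInputs», unit U4 «Keys» — (U4f-χ₁-ram-one-d0B) step Z2-B, generic part: IN BRANCH B A TYPE VECTOR KILLED BY THE TWO INTERTWINING FUNCTIONALS
# FORCES `det M = 0`, `M = [[Λ_{g₁} f₁, Λ_{g₁} f_w], [Λ_{g₂} f₁, Λ_{g₂} f_w]]`, `Λ_g(φ) = ∫_N φ(w₀ n g) dn`   [Casselman1980 §3; Casselman1995 §6.3–§6.4; Keys1984 §3; Roche1998 §3–§4]

Cell `pub/hodgecm-mathlib`, crux H413 = `stmt-HodgeConjecture-24833`, route of record `HCCMUnconditional`; chair K2-lead (g2), LINE-LEAD∕dealer K2E3-plan (g4), architect K2E3-p25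
(g3); cell «U4-RAM».  THEOREMS ONLY (no `def`, no `instance`, no `notation`, no named-fact hypothesis, no `sorry`); lane `--supports stmt-HodgeConjecture-24833 --as helper`,
count-neutral.  NOT THE PAYER: the socket :155 stays OPEN (the existence of the type basis `f₁, f_w`, the values of the four integrals, the ramified∕dyadic places remain).

THE POINT (DESIGN-M2-v2 (O2), K2E3-p06 (g4)).  Design D-I «vanishing functional»: if `i(χ) = Ind_P^G χδ^{1∕2}` is reducible, ★ V1 `K2E3IntertwiningKernelOfReducible` gives a `G`-stable
`V` on which EVERY intertwining integral `Λ_g(φ) = ∫_N φ(w₀ n g) dn` vanishes, and ★ V2b∕Z2A turn a member into an `(I, χ̃)`-TYPE VECTOR `f ∈ V` with `f(1) ≠ 0`.  In BRANCH A the type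
space is the LINE `ℂf₁` and ONE functional gives the contradiction (★ Z2A-4 `K2E3BranchAContradiction`).  In BRANCH B (`w₀ ∈ W_χ`) the type space is the PLANE `ℂf₁ ⊕ ℂf_w` (`f₁`
supported on `P·I`, `f_w` on `P·w₀·I`, normalised `f₁(1) = 1, f₁(w₀) = 0, f_w(1) = 0, f_w(w₀) = 1`): by ★ Z2 `eq_of_eigen_of_apply_eq` (`G = P·I ∪ P·w₀·I`) every type vector is
`f = f(1)·f₁ + f(w₀)·f_w` (§2), so the two vanishing integrals `Λ_{g₁} f = Λ_{g₂} f = 0` (print: `g₁ = 1`, `g₂ = w₀`) read `M·(f(1), f(w₀))ᵀ = 0` with the `2 × 2` matrix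
`M = [[Λ_{g₁}f₁, Λ_{g₁}f_w], [Λ_{g₂}f₁, Λ_{g₂}f_w]]` (§3, linearity of the Bochner integral GIVEN the integrability of the four cell integrals — the absolutely convergent `G₁, G₂` and the two
volumes of PAPER-Z3 §1), and `f(1) ≠ 0` forces **`det M = Λ_{g₁}f₁·Λ_{g₂}f_w − Λ_{g₁}f_w·Λ_{g₂}f₁ = 0`** (§4).  With PAPER-Z3's values this is `G₁G₂ − vol·vol = 0`, whence ★ Z4
`K2E3BranchBDeterminantRoots` (`Y = −1∕q`) and ★ Z5 `K2E3KeysThmTwoDepthZeroBranchBConversion` (this seat) give Keys (b)–(d).  Everything here is GENERIC: a topological group `G`, subgroups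
`H` (= `P`), `B` (= `I`), `N`, a one-dimensional `τ` of `H`, a multiplier `θ : G → ℂ` (= `χ̃`), elements `g₀` (cell representative), `w₀, g₁, g₂`, a measure `μ` on `↥N`.
* §1 `eigen_smul_add_smul` — linear combinations of `(B, θ)`-eigen-sections are `(B, θ)`-eigen.
* §2 **`eq_smul_add_smul_of_eigen`** — `f = f(1)·f₁ + f(g₀)·f_w` for a type vector `f` and a NORMALISED type basis (`G = H·B ∪ H·g₀·B`).
* §3 `integral_conj_mul_eq_of_eq_smul_add_smul` — `Λ_g(a f₁ + b f_w) = a Λ_g f₁ + b Λ_g f_w` (integrable cell integrals).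
* §4 `det_eq_zero_of_kernel_vector_fst_ne_zero` (the `2 × 2` algebra), **`det_intertwiningIntegral_eq_zero_of_typeVector`** — THE BRICK.
HONEST LABEL.  HC_CM is proved only modulo the 7 printed citations (2 remaining named inputs: hLiu418 = `stmt-HodgeConjecture-24832`, h413 = `stmt-HodgeConjecture-24833`) until rung 0
closes; count-neutral — this file does NOT pay the leaf; no printed citation is discharged.

## References
* [Casselman1980] W. Casselman, *The unramified principal series of p-adic groups I*, Compositio Math. 40 (1980), §3 (the functionals on the Iwahori-fixed vectors and their matrix).
* [Casselman1995] W. Casselman, *Introduction to the theory of admissible representations of `p`-adic reductive groups* (1995), §6.3–§6.4, Thm. 6.6.2.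
* [Keys1984] D. Keys, *Principal series representations of special unitary groups over local fields*, Compositio Math. 51 (1984), §3, §7 Theorem (2) p. 126.
* [Roche1998] A. Roche, Ann. Sci. ÉNS (4) 31 (1998), §3–§4 (types for principal series; the two-dimensional Hecke module when `w₀ ∈ W_χ`).
-/

set_option autoImplicit false
-- the mandated namespace has the single-problem summit's repeated segment (`HodgeConjecture.HodgeConjecture`)
set_option linter.dupNamespace false

noncomputable section

open MeasureTheory

namespace Summit.HodgeConjecture.HodgeConjecture.Cruxes.H413.K2E3BranchBDeterminantVanishing

open Summit.HodgeConjecture.HodgeConjecture.Cruxes.H413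
open Literature.NumberTheory.Automorphic Representation

variable {G : Type*} [Group G] [TopologicalSpace G] [IsTopologicalGroup G] (H : Subgroup G) (τ : Representation ℂ ↥H ℂ)

/-! ## §1 Linear combinations of type vectors are type vectors -/

/-- **`a·f₁ + b·f₂` is `(B, θ)`-eigen if `f₁, f₂` are** (the `(B, θ)`-type vectors form a subspace). [cite: Roche1998, §3–§4] -/
theorem eigen_smul_add_smul (B : Subgroup G) (θ : G → ℂ) (f₁ f₂ : Representation.SmoothInd H τ)
    (heig₁ : ∀ x ∈ B, Representation.smoothIndRep H τ x f₁ = θ x • f₁) (heig₂ : ∀ x ∈ B, Representation.smoothIndRep H τ x f₂ = θ x • f₂) (a b : ℂ) :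
    ∀ x ∈ B, Representation.smoothIndRep H τ x (a • f₁ + b • f₂) = θ x • (a • f₁ + b • f₂) := by
  intro x hx
  rw [map_add, map_smul, map_smul, heig₁ x hx, heig₂ x hx, smul_add, smul_comm (θ x) a, smul_comm (θ x) b]

/-! ## §2 A type vector in the coordinates of a normalised type basis -/

/-- **`f = f(1)·f₁ + f(g₀)·f_w`** for a `(B, θ)`-type vector `f` and a NORMALISED `(B, θ)`-type basis (`f₁(1) = 1`, `f₁(g₀) = 0`, `f_w(1) = 0`, `f_w(g₀) = 1`), when `G = H·B ∪ H·g₀·B`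
(both sides are `(B, θ)`-eigen and agree at `1` and `g₀`; ★ Z2 `eq_of_eigen_of_apply_eq`).  Print: the `(I, χ̃)`-plane `ℂf₁ ⊕ ℂf_w` of `i(χ)` in Branch B. [cite: Roche1998, §3–§4]
[cite: Casselman1995, §6.3] -/
theorem eq_smul_add_smul_of_eigen (B : Subgroup G) (θ : G → ℂ) (g₀ : G)
    (hcover : ∀ y : G, (∃ h ∈ H, ∃ b ∈ B, y = h * b) ∨ ∃ h ∈ H, ∃ b ∈ B, y = h * g₀ * b)
    (f₁ f_w f : Representation.SmoothInd H τ)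
    (heig₁ : ∀ x ∈ B, Representation.smoothIndRep H τ x f₁ = θ x • f₁) (heig_w : ∀ x ∈ B, Representation.smoothIndRep H τ x f_w = θ x • f_w)
    (heig : ∀ x ∈ B, Representation.smoothIndRep H τ x f = θ x • f)
    (h11 : f₁.toFun 1 = 1) (h1g : f₁.toFun g₀ = 0) (hw1 : f_w.toFun 1 = 0) (hwg : f_w.toFun g₀ = 1) :
    f = f.toFun 1 • f₁ + f.toFun g₀ • f_w := by
  refine K2E3IwahoriPlaneTwoCells.eq_of_eigen_of_apply_eq H τ B θ g₀ hcover f _ heig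
    (eigen_smul_add_smul H τ B θ f₁ f_w heig₁ heig_w (f.toFun 1) (f.toFun g₀)) ?_ ?_
  · rw [SmoothInd.toFun_add, SmoothInd.toFun_smul, SmoothInd.toFun_smul, Pi.add_apply, Pi.smul_apply, Pi.smul_apply, smul_eq_mul, smul_eq_mul,
      h11, hw1, mul_one, mul_zero, add_zero]
  · rw [SmoothInd.toFun_add, SmoothInd.toFun_smul, SmoothInd.toFun_smul, Pi.add_apply, Pi.smul_apply, Pi.smul_apply, smul_eq_mul, smul_eq_mul,
      h1g, hwg, mul_zero, mul_one, zero_add]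

/-! ## §3 The intertwining integral of a combination -/

/-- **`Λ_g(a·f₁ + b·f_w) = a·Λ_g(f₁) + b·Λ_g(f_w)`** for `Λ_g(φ) := ∫_N φ(w₀ n g) dμ(n)`, given the integrability of the two cell integrals (linearity of the Bochner integral; print: the
absolutely convergent `G₁, G₂` and the two volumes of the Casselman pair). [cite: Casselman1980, §3] [cite: Casselman1995, §6.4] -/
theorem integral_conj_mul_eq_of_eq_smul_add_smul (N : Subgroup G) [MeasurableSpace ↥N] (μ : Measure ↥N) (w₀ g : G)
    (f₁ f_w f : Representation.SmoothInd H τ) (a b : ℂ) (hf : f = a • f₁ + b • f_w)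
    (hi₁ : Integrable (fun n : ↥N => f₁.toFun (w₀ * (n : G) * g)) μ) (hi_w : Integrable (fun n : ↥N => f_w.toFun (w₀ * (n : G) * g)) μ) :
    ∫ n : ↥N, f.toFun (w₀ * (n : G) * g) ∂μ = a * ∫ n : ↥N, f₁.toFun (w₀ * (n : G) * g) ∂μ + b * ∫ n : ↥N, f_w.toFun (w₀ * (n : G) * g) ∂μ := by
  have hfun : (fun n : ↥N => f.toFun (w₀ * (n : G) * g)) = fun n : ↥N => a * f₁.toFun (w₀ * (n : G) * g) + b * f_w.toFun (w₀ * (n : G) * g) := by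
    funext n
    rw [hf, SmoothInd.toFun_add, SmoothInd.toFun_smul, SmoothInd.toFun_smul, Pi.add_apply, Pi.smul_apply, Pi.smul_apply, smul_eq_mul, smul_eq_mul]
  rw [hfun, integral_add (hi₁.const_mul a) (hi_w.const_mul b), integral_const_mul, integral_const_mul]

/-! ## §4 `det M = 0` -/

/-- The `2 × 2` algebra: a kernel vector `(a, b)` of `M = [[m₁₁, m₁₂], [m₂₁, m₂₂]]` with `a ≠ 0` forces `det M = m₁₁m₂₂ − m₁₂m₂₁ = 0`. [cite: Casselman1980, §3] -/
theorem det_eq_zero_of_kernel_vector_fst_ne_zero {a b m₁₁ m₁₂ m₂₁ m₂₂ : ℂ} (ha : a ≠ 0) (h1 : a * m₁₁ + b * m₁₂ = 0) (h2 : a * m₂₁ + b * m₂₂ = 0) :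
    m₁₁ * m₂₂ - m₁₂ * m₂₁ = 0 := by
  have h : a * (m₁₁ * m₂₂ - m₁₂ * m₂₁) = 0 := by linear_combination m₂₂ * h1 - m₁₂ * h2
  exact (mul_eq_zero.1 h).resolve_left ha

/-- **IN BRANCH B, «REDUCIBLE ⟹ det M = 0».**  Let `f₁, f_w` be a NORMALISED `(B, θ)`-type basis of `Ind_H^G τ` over the cover `G = H·B ∪ H·g₀·B` (`f₁(1) = 1, f₁(g₀) = 0, f_w(1) = 0,
f_w(g₀) = 1`), `Λ_g(φ) := ∫_N φ(w₀ n g) dμ(n)` with the four cell integrals `Λ_{g₁}f₁, Λ_{g₁}f_w, Λ_{g₂}f₁, Λ_{g₂}f_w` integrable, and `f` a `(B, θ)`-TYPE VECTOR with `f(1) ≠ 0`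
KILLED by `Λ_{g₁}` and `Λ_{g₂}` (★ V1 `K2E3IntertwiningKernelOfReducible`: every `Λ_g` vanishes on the `G`-stable `V` of a reducible `i(χ)`; ★ V2b∕Z2A: the type vector in `V`).  Then
**`Λ_{g₁}f₁ · Λ_{g₂}f_w − Λ_{g₁}f_w · Λ_{g₂}f₁ = 0`** — the determinant of the Casselman-pair matrix vanishes (print: `g₁ = 1`, `g₂ = w₀`, `det M = G₁G₂ − vol(N₀)·vol(N(𝔭))`, PAPER-Z3 §2).
[cite: Casselman1980, §3] [cite: Casselman1995, §6.4, Thm. 6.6.2] [cite: Keys1984, §3, §7 Theorem (2) p. 126] [cite: Roche1998, §3–§4] -/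
theorem det_intertwiningIntegral_eq_zero_of_typeVector (B : Subgroup G) (θ : G → ℂ) (g₀ : G)
    (hcover : ∀ y : G, (∃ h ∈ H, ∃ b ∈ B, y = h * b) ∨ ∃ h ∈ H, ∃ b ∈ B, y = h * g₀ * b)
    (N : Subgroup G) [MeasurableSpace ↥N] (μ : Measure ↥N) (w₀ g₁ g₂ : G)
    (f₁ f_w : Representation.SmoothInd H τ)
    (heig₁ : ∀ x ∈ B, Representation.smoothIndRep H τ x f₁ = θ x • f₁) (heig_w : ∀ x ∈ B, Representation.smoothIndRep H τ x f_w = θ x • f_w)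
    (h11 : f₁.toFun 1 = 1) (h1g : f₁.toFun g₀ = 0) (hw1 : f_w.toFun 1 = 0) (hwg : f_w.toFun g₀ = 1)
    (hi₁₁ : Integrable (fun n : ↥N => f₁.toFun (w₀ * (n : G) * g₁)) μ) (hiw₁ : Integrable (fun n : ↥N => f_w.toFun (w₀ * (n : G) * g₁)) μ)
    (hi₁₂ : Integrable (fun n : ↥N => f₁.toFun (w₀ * (n : G) * g₂)) μ) (hiw₂ : Integrable (fun n : ↥N => f_w.toFun (w₀ * (n : G) * g₂)) μ)
    (f : Representation.SmoothInd H τ) (heig : ∀ x ∈ B, Representation.smoothIndRep H τ x f = θ x • f) (hf1 : f.toFun 1 ≠ 0)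
    (hΛ₁ : ∫ n : ↥N, f.toFun (w₀ * (n : G) * g₁) ∂μ = 0) (hΛ₂ : ∫ n : ↥N, f.toFun (w₀ * (n : G) * g₂) ∂μ = 0) :
    (∫ n : ↥N, f₁.toFun (w₀ * (n : G) * g₁) ∂μ) * (∫ n : ↥N, f_w.toFun (w₀ * (n : G) * g₂) ∂μ) -
      (∫ n : ↥N, f_w.toFun (w₀ * (n : G) * g₁) ∂μ) * (∫ n : ↥N, f₁.toFun (w₀ * (n : G) * g₂) ∂μ) = 0 := by
  have hf := eq_smul_add_smul_of_eigen H τ B θ g₀ hcover f₁ f_w f heig₁ heig_w heig h11 h1g hw1 hwg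
  have h1 := integral_conj_mul_eq_of_eq_smul_add_smul H τ N μ w₀ g₁ f₁ f_w f (f.toFun 1) (f.toFun g₀) hf hi₁₁ hiw₁
  have h2 := integral_conj_mul_eq_of_eq_smul_add_smul H τ N μ w₀ g₂ f₁ f_w f (f.toFun 1) (f.toFun g₀) hf hi₁₂ hiw₂
  rw [hΛ₁] at h1
  rw [hΛ₂] at h2
  exact det_eq_zero_of_kernel_vector_fst_ne_zero hf1 h1.symm h2.symm

end Summit.HodgeConjecture.HodgeConjecture.Cruxes.H413.K2E3BranchBDeterminantVanishing

end
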